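import Mathlib.NumberTheory.NumberField.InfinitePlace.Embeddings
import Mathlib.NumberTheory.Padics.Complex
import Mathlib.NumberTheory.RamificationInertia.Basic
import Literature.IUT.LogVolume.Corollary22Statement
import Literature.IUT.LogVolume.FakeAdeleIndex
import HarnessLib

/-!
# [IUTchIV] Corollary 2.2 (i), first equivalence: `(1/6)·log(q^{∤2}) ≈ (1/6)·log(q^∀)` on `K_V`
# from the hypothesis (∗^{j-inv}) — the 2-adic contribution to `log(q^∀)` is bounded

Mochizuki, *Inter-universal Teichmüller theory IV*, RIMS manuscript (Apr. 2020) = PRIMS **57**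
(2021), Cor. 2.2 (i), p. 41, with its proof p. 44: "the equality of BD-classes
`(1/6)·log(q^{∤2}) ≈ (1/6)·log(q^∀)` follows from condition (∗^{j-inv})" (the image of
`K_2 ⊆ U_X(ℚ̄_2)` under the `j`-invariant is bounded, "i.e., is contained in a subset of the form
`2^{N_{j-inv}}·O_{ℚ̄_2}`", p. 41) [claim: Mochizuki2012, status: disputed — this particular
equivalence is CLASSICAL valuation theory and is PROVED here unconditionally].

PROOF-ONLY companion of `Literature/IUT/LogVolume/Corollary22Statement.lean` (abc-iut-S3):
discharges the FIRST conjunct of `Cor22.PartI D` under `Cor22.Hypotheses D`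
(`Cor22.partI_first`) UNCONDITIONALLY — no named fact, in particular no "dictionary" between the
places `v ∣ 2` of `F` and the embeddings `F → ℚ̄_2` is needed. Content:

* **Integrality at all 2-adic embeddings forces integrality at all places over 2**
  (`Cor22.valuation_le_one_of_forall_norm_embedding_le_one`): for a number field `F`, a prime
  `p` and `z ∈ F`, if `‖σ(z)‖ ≤ 1` for every embedding `σ : F → ℚ̄_p` (Mathlib `PadicAlgCl p`),
  then `v(z) ≤ 1` at every finite place `v ∣ p`. Proof WITHOUT the completion dictionary: the
  monic minimal polynomial of `z` over `ℚ` splits in `ℚ̄_p` with roots the `σ(z)` (Mathlib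
  `NumberField.Embeddings.range_eval_eq_rootSet_minpoly`), so by the ultrametric inequality its
  coefficients have `p`-adic norm `≤ 1`, i.e. denominators prime to `p`; hence they are `v`-integral
  for `v ∣ p`, and a monic `v`-integral relation forces `v(z) ≤ 1` (strict triangle inequality).
* **The bound** (`Cor22.logQForall_sub_logQNotTwo_le`): for `P = (F, λ) ∈ K_V` one has, for all
  `σ : F → ℚ̄_2`, `σ(λ) ∈ K_2`, so `‖j(σ(λ))‖ = ‖σ(j(λ))‖ ≤ C ≤ 2^a`; then `2^a·j(λ)` is integral
  at every `v ∣ 2`, i.e. `−ord_v(j(λ)) ≤ a·ord_v(2) = a·e_v`, so the 2-adic part of `log(q^∀)` is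
  `(1/[F:ℚ])·Σ_{v∣2, bad} h_v·log N(v) ≤ (a·log 2/[F:ℚ])·Σ_{v∣2} e_v f_v = a·log 2`
  (fundamental identity, `Literature.IUT.LogVolume.sum_localDegree`).

No new definitions; nothing here takes a side on [IUTchIII] Cor. 3.12.
-/

noncomputable section

namespace Literature.IUT.LogVolume

namespace Cor22

open Polynomial NumberField IsDedekindDomain
open Literature.NumberTheory.DiophantineGeometry.GenEll

/-! ## Integrality at all `p`-adic embeddings ⟹ integrality at all places over `p` -/

/-- In an ultrametric normed field, a product `Π (X − r)` over roots `r` with `‖r‖ ≤ 1` has all its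
coefficients of norm `≤ 1`. [cite: Mochizuki2012, Cor 2.2 (i) p.41] -/
theorem norm_coeff_prod_X_sub_C_le_one {A : Type*} [NormedField A] [IsUltrametricDist A]
    (s : Multiset A) (hs : ∀ r ∈ s, ‖r‖ ≤ 1) (k : ℕ) :
    ‖((s.map (fun r => X - C r)).prod).coeff k‖ ≤ 1 := by
  induction s using Multiset.induction_on generalizing k with
  | empty =>
    simp only [Multiset.map_zero, Multiset.prod_zero, coeff_one]
    split_ifs <;> simp
  | cons a s ih =>
    rw [Multiset.map_cons, Multiset.prod_cons]
    have ha : ‖a‖ ≤ 1 := hs a (Multiset.mem_cons_self a s)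
    have hs' : ∀ r ∈ s, ‖r‖ ≤ 1 := fun r hr => hs r (Multiset.mem_cons_of_mem hr)
    cases k with
    | zero =>
      rw [mul_coeff_zero]
      simp only [coeff_sub, coeff_X_zero, coeff_C_zero, zero_sub, norm_mul, norm_neg]
      exact mul_le_one₀ ha (norm_nonneg _) (ih hs' 0)
    | succ k =>
      rw [coeff_X_sub_C_mul, sub_eq_add_neg]
      refine (IsUltrametricDist.norm_add_le_max _ _).trans (max_le (ih hs' k) ?_)
      rw [norm_neg, norm_mul]
      exact mul_le_one₀ ha (norm_nonneg _) (ih hs' (k + 1))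

/-- If every conjugate of `x ∈ K` (number field) in an algebraically closed ultrametric field `A`
has norm `≤ 1`, then every coefficient of the minimal polynomial of `x` over `ℚ` has norm `≤ 1`
in `A` (nonarchimedean analogue of Mathlib's `NumberField.Embeddings.coeff_bdd_of_norm_le`).
[cite: Mochizuki2012, Cor 2.2 (i) p.41] -/
theorem norm_algebraMap_coeff_minpoly_le_one {K : Type*} [Field K] [NumberField K]
    {A : Type*} [NormedField A] [IsUltrametricDist A] [Algebra ℚ A] [IsAlgClosed A] {x : K}
    (h : ∀ φ : K →+* A, ‖φ x‖ ≤ 1) (i : ℕ) :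
    ‖algebraMap ℚ A ((minpoly ℚ x).coeff i)‖ ≤ 1 := by
  have hx : IsIntegral ℚ x := Algebra.IsSeparable.isIntegral ℚ x
  rw [← coeff_map]
  have hsplit : ((minpoly ℚ x).map (algebraMap ℚ A)).Splits := IsAlgClosed.splits _
  have hmon : ((minpoly ℚ x).map (algebraMap ℚ A)).Monic := (minpoly.monic hx).map _
  rw [hsplit.eq_prod_roots_of_monic hmon]
  refine norm_coeff_prod_X_sub_C_le_one _ (fun z hz => ?_) i
  classical
  rw [← Multiset.mem_toFinset] at hz
  obtain ⟨φ, rfl⟩ := (NumberField.Embeddings.range_eval_eq_rootSet_minpoly K A x).symm.subset hz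
  exact h φ

/-- A rational number whose image in `ℚ̄_p` has norm `≤ 1` has denominator prime to `p`.
[cite: Mochizuki2012, Cor 2.2 (i) p.41] -/
theorem not_dvd_den_of_norm_le_one {p : ℕ} [Fact p.Prime] {c : ℚ}
    (h : ‖algebraMap ℚ (PadicAlgCl p) c‖ ≤ 1) : ¬ p ∣ c.den := by
  have h1 : ‖(c : ℚ_[p])‖ ≤ 1 := by
    rw [eq_ratCast, ← map_ratCast (algebraMap ℚ_[p] (PadicAlgCl p)) c] at h
    rwa [PadicAlgCl.norm_extends] at h
  rw [Padic.eq_padicNorm] at h1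
  have h1' : padicNorm p c ≤ 1 := by exact_mod_cast h1
  intro hdvd
  have hp : p.Prime := Fact.out
  -- `p ∣ den` forces `p ∤ num` (lowest terms), so `|c|_p = |num|_p / |den|_p = 1/|den|_p > 1`
  have hnum : ¬ (p : ℤ) ∣ c.num := by
    intro hn
    have hcop := c.reduced
    have : p ∣ Nat.gcd c.num.natAbs c.den :=
      Nat.dvd_gcd (Int.natCast_dvd.mp (by simpa using hn)) hdvd
    rw [hcop] at this
    exact hp.one_lt.ne' (Nat.dvd_one.mp this)
  have hnum1 : padicNorm p (c.num : ℚ) = 1 := (padicNorm.int_eq_one_iff _).mpr hnum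
  have hden1 : padicNorm p (c.den : ℚ) < 1 := (padicNorm.nat_lt_one_iff _).mpr hdvd
  have hden0 : 0 < padicNorm p (c.den : ℚ) :=
    lt_of_le_of_ne (padicNorm.nonneg _) (padicNorm.nonzero (by exact_mod_cast c.den_ne_zero)).symm
  have hc : padicNorm p c = padicNorm p (c.num : ℚ) / padicNorm p (c.den : ℚ) := by
    conv_lhs => rw [← c.num_div_den]
    exact padicNorm.div _ _
  rw [hc, hnum1] at h1'
  have : 1 < 1 / padicNorm p (c.den : ℚ) := by
    rw [lt_div_iff₀ hden0, one_mul]; exact hden1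
  linarith

/-- A rational number with denominator prime to `p` is integral at every place `v ∣ p` of a number
field. [cite: Mochizuki2012, Cor 2.2 (i) p.41] -/
theorem valuation_ratCast_le_one {F : Type*} [Field F] [NumberField F]
    (v : HeightOneSpectrum (𝓞 F)) {p : ℕ} [Fact p.Prime] (hv : (p : 𝓞 F) ∈ v.asIdeal) {c : ℚ}
    (hc : ¬ p ∣ c.den) : v.valuation F (c : F) ≤ 1 := by
  have hp : p.Prime := Fact.out
  have hden : v.valuation F (c.den : F) = 1 := by
    have hle : v.valuation F (c.den : F) ≤ 1 := by
      have := v.valuation_le_one (K := F) (c.den : 𝓞 F)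
      simpa using this
    refine le_antisymm hle (not_lt.mp fun hlt => ?_)
    have hmem : (c.den : 𝓞 F) ∈ v.asIdeal := by
      have := (v.valuation_lt_one_iff_mem (K := F) (c.den : 𝓞 F))
      exact this.mp (by simpa using hlt)
    have hcop : IsCoprime (c.den : ℤ) (p : ℤ) :=
      Nat.isCoprime_iff_coprime.mpr ((Nat.Prime.coprime_iff_not_dvd hp).mpr hc).symm
    obtain ⟨a, b, hab⟩ := hcop
    have h1 : (1 : 𝓞 F) ∈ v.asIdeal := by
      have hcast := congrArg (Int.cast : ℤ → 𝓞 F) hab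
      push_cast at hcast
      rw [← hcast]
      exact v.asIdeal.add_mem (v.asIdeal.mul_mem_left _ hmem) (v.asIdeal.mul_mem_left _ hv)
    exact v.isPrime.ne_top ((Ideal.eq_top_iff_one _).mpr h1)
  have hnum : v.valuation F (c.num : F) ≤ 1 := by
    have := v.valuation_le_one (K := F) (c.num : 𝓞 F)
    simpa using this
  rw [Rat.cast_def, map_div₀, hden, div_one]
  exact hnum

/-- A monic relation with `v`-integral coefficients forces `v`-integrality: if every coefficient of
the minimal polynomial of `z` over `ℚ` has `v`-valuation `≤ 1`, then `v(z) ≤ 1` (strict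
ultrametric inequality). [cite: Mochizuki2012, Cor 2.2 (i) p.41] -/
theorem valuation_le_one_of_minpoly_coeff {F : Type*} [Field F] [NumberField F]
    (v : HeightOneSpectrum (𝓞 F)) {z : F}
    (h : ∀ i, v.valuation F (((minpoly ℚ z).coeff i : ℚ) : F) ≤ 1) : v.valuation F z ≤ 1 := by
  by_contra hz
  rw [not_le] at hz
  have hint : IsIntegral ℚ z := Algebra.IsSeparable.isIntegral ℚ z
  have hm := minpoly.monic hint
  have h0 : aeval z (minpoly ℚ z) = 0 := minpoly.aeval ℚ z
  rw [aeval_eq_sum_range, Finset.sum_range_succ, hm.coeff_natDegree, one_smul] at h0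
  set n := (minpoly ℚ z).natDegree
  have hz0 : v.valuation F z ≠ 0 := ne_of_gt (lt_trans zero_lt_one hz)
  have hzn : v.valuation F (z ^ n) = v.valuation F z ^ n := map_pow _ _ _
  have hlt : v.valuation F (∑ i ∈ Finset.range n, (minpoly ℚ z).coeff i • z ^ i) <
      v.valuation F (z ^ n) := by
    rw [hzn]
    refine Valuation.map_sum_lt _ (pow_ne_zero _ hz0) fun i hi => ?_
    rw [Finset.mem_range] at hi
    rw [Algebra.smul_def, map_mul, map_pow, eq_ratCast]
    calc v.valuation F ((minpoly ℚ z).coeff i : F) * v.valuation F z ^ i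
        ≤ 1 * v.valuation F z ^ i := mul_le_mul_left (h i) _
      _ < v.valuation F z ^ n := by rw [one_mul]; exact pow_lt_pow_right₀ hz hi
  have heq := Valuation.map_add_eq_of_lt_right (v := v.valuation F) hlt
  rw [h0, map_zero, hzn] at heq
  exact pow_ne_zero _ hz0 heq.symm

/-- **Integrality at all `p`-adic embeddings ⟹ integrality at all places over `p`.** For a number
field `F`, a prime `p` and `z ∈ F`: if `‖σ(z)‖ ≤ 1` for every embedding `σ : F → ℚ̄_p`, then
`v(z) ≤ 1` for every finite place `v ∣ p` of `F`. [cite: Mochizuki2012, Cor 2.2 (i) p.41] -/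
theorem valuation_le_one_of_forall_norm_embedding_le_one {F : Type*} [Field F] [NumberField F]
    (p : ℕ) [Fact p.Prime] {z : F} (h : ∀ σ : F →+* PadicAlgCl p, ‖σ z‖ ≤ 1)
    (v : HeightOneSpectrum (𝓞 F)) (hv : (p : 𝓞 F) ∈ v.asIdeal) : v.valuation F z ≤ 1 :=
  valuation_le_one_of_minpoly_coeff v fun i =>
    valuation_ratCast_le_one v hv
      (not_dvd_den_of_norm_le_one (norm_algebraMap_coeff_minpoly_le_one h i))

/-! ## From valuations to the order function `ord_v` and the ramification index -/

/-- `v(x) ≤ 1` with `x ≠ 0` means `ord_v(x) ≥ 0`. [cite: Mochizuki2012, Cor 2.2 (i) p.41] -/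
theorem ord_nonneg_of_valuation_le_one {F : Type*} [Field F] [NumberField F]
    (v : HeightOneSpectrum (𝓞 F)) {x : F} (hx : x ≠ 0) (h : v.valuation F x ≤ 1) :
    0 ≤ ord F v x := by
  unfold ord
  rw [neg_nonneg, ← WithZero.log_one]
  exact (WithZero.log_le_log ((v.valuation F).ne_zero_iff.mpr hx) one_ne_zero).mpr h

/-- A finite place containing the rational prime `p` lies over `p` (`v ∈ V(F)_p`).
[cite: Mochizuki2012, Cor 2.2 (i) p.41] -/
theorem mem_placesOver_of_natCast_mem {F : Type*} [Field F] [NumberField F] (p : ℕ) [Fact p.Prime]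
    (v : HeightOneSpectrum (𝓞 F)) (hv : (p : 𝓞 F) ∈ v.asIdeal) : v ∈ placesOver F p := by
  rw [mem_placesOver_iff_residueChar]
  have hle : Ideal.span {(p : ℤ)} ≤ v.asIdeal.under ℤ := by
    rw [Ideal.span_le, Set.singleton_subset_iff, SetLike.mem_coe, Ideal.under_def, Ideal.mem_comap,
      map_natCast]
    exact hv
  have hdvd : Ideal.absNorm (v.asIdeal.under ℤ) ∣ p := by
    have h := Ideal.absNorm_dvd_absNorm_of_le hle
    rw [Ideal.absNorm_span_singleton] at h
    simpa using h
  exact (Nat.prime_dvd_prime_iff_eq (residueChar_prime F v) Fact.out).mp hdvd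

/-- At a place `v ∣ p`, `ord_v(p) = e_v` (the ramification index; both are the multiplicity of `v`
in `p·𝓞_F`). [cite: Mochizuki2012, Cor 2.2 (i) p.41] -/
theorem ord_natCast_eq_ramIdx {F : Type*} [Field F] [NumberField F] (p : ℕ) [Fact p.Prime]
    (v : HeightOneSpectrum (𝓞 F)) (hv : v ∈ placesOver F p) :
    ord F v (p : F) = ramIdx F v := by
  have hp : residueChar F v = p := (mem_placesOver_iff_residueChar v).mp hv
  have hp0 : (p : 𝓞 F) ≠ 0 := by exact_mod_cast (Fact.out : p.Prime).ne_zero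
  have h1 : ord F v (p : F) = multiplicity v.asIdeal (Ideal.span {(p : 𝓞 F)}) := by
    unfold ord
    rw [show (p : F) = algebraMap (𝓞 F) F (p : 𝓞 F) by simp,
      HeightOneSpectrum.valuation_of_algebraMap,
      HeightOneSpectrum.intValuation_eq_exp_neg_multiplicity _ hp0, WithZero.log_exp, neg_neg]
  have hmap : Ideal.map (algebraMap ℤ (𝓞 F)) (Ideal.span {(p : ℤ)}) = Ideal.span {(p : 𝓞 F)} := by
    rw [Ideal.map_span, Set.image_singleton, map_natCast]
  have hne : Ideal.map (algebraMap ℤ (𝓞 F)) (Ideal.span {(p : ℤ)}) ≠ ⊥ := by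
    rw [hmap, Ne, Ideal.span_singleton_eq_bot]
    exact hp0
  have h2 : ramIdx F v = multiplicity v.asIdeal (Ideal.span {(p : 𝓞 F)}) := by
    rw [ramIdx, hp, Ideal.IsDedekindDomain.ramificationIdx'_eq_multiplicity hne v.isPrime, hmap]
  rw [h1, h2]

/-! ## The 2-adic part of `log(q^∀)` on `K_V` -/

/-- `j` commutes with homomorphisms of fields: `σ(j(λ)) = j(σ(λ))`.
[cite: Mochizuki2012, Cor 2.2 (i) p.41] -/
theorem ringHom_map_jInv {K L : Type*} [Field K] [Field L] (σ : K →+* L) (t : K) :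
    σ (jInv t) = jInv (σ t) := by
  simp [jInv, map_div₀, map_ofNat]

/-- `‖2‖ = 1/2` in `ℚ̄_2`. [cite: Mochizuki2012, Cor 2.2 (i) p.41] -/
theorem norm_two_padicAlgCl : ‖(2 : PadicAlgCl 2)‖ = 2⁻¹ := by
  have h : (2 : PadicAlgCl 2) = ((2 : ℚ_[2]) : PadicAlgCl 2) := (map_ofNat _ 2).symm
  rw [h, PadicAlgCl.norm_extends]
  have := Padic.norm_p (p := 2)
  simpa using this

variable {D : CBData}

/-- **(∗^{j-inv}) made effective.** Under the hypotheses of Cor. 2.2 on `K_V` there is an `a ∈ ℕ`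
with `‖σ(2^a·j(λ))‖ ≤ 1` for every `P = (F, λ) ∈ K_V` and every embedding `σ : F → ℚ̄_2`
(`σ(λ) ∈ K_2`, `‖j(σ(λ))‖ ≤ C ≤ 2^a`). [cite: Mochizuki2012, Cor 2.2 (i) p.41] -/
theorem exists_norm_embedding_two_pow_mul_jInv_le_one (hD : Hypotheses D) :
    ∃ a : ℕ, ∀ P ∈ D.toSet, ∀ σ : P.F →+* PadicAlgCl 2, ‖σ ((2 : P.F) ^ a * jInv P.x)‖ ≤ 1 := by
  obtain ⟨C, hC⟩ := hD.jinv
  obtain ⟨a, ha⟩ : ∃ a : ℕ, C ≤ 2 ^ a :=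
    ⟨⌈C⌉₊, (Nat.le_ceil C).trans (by exact_mod_cast Nat.lt_two_pow_self.le)⟩
  refine ⟨a, fun P hP σ => ?_⟩
  have h2 : (2 : ℕ) ∈ D.primes := hD.supp (Finset.mem_singleton_self 2)
  have hmem : σ P.x ∈ D.Knon 2 := hP.2 2 h2 σ
  have hj : ‖σ (jInv P.x)‖ ≤ C := by rw [ringHom_map_jInv]; exact hC _ hmem
  rw [map_mul, map_pow, map_ofNat, norm_mul, norm_pow, norm_two_padicAlgCl, inv_pow,
    inv_mul_le_iff₀ (by positivity), mul_one]
  exact hj.trans ha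

/-- For `P = (F, λ) ∈ K_V` and `v ∣ 2`: `2^a·j(λ)` is `v`-integral, by
`valuation_le_one_of_forall_norm_embedding_le_one`. [cite: Mochizuki2012, Cor 2.2 (i) p.41] -/
theorem exists_valuation_two_pow_mul_jInv_le_one (hD : Hypotheses D) :
    ∃ a : ℕ, ∀ P ∈ D.toSet, ∀ v : HeightOneSpectrum (𝓞 P.F), (2 : 𝓞 P.F) ∈ v.asIdeal →
      v.valuation P.F ((2 : P.F) ^ a * jInv P.x) ≤ 1 := by
  obtain ⟨a, ha⟩ := exists_norm_embedding_two_pow_mul_jInv_le_one hD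
  refine ⟨a, fun P hP v hv => ?_⟩
  have hv' : ((2 : ℕ) : 𝓞 P.F) ∈ v.asIdeal := by simpa using hv
  exact valuation_le_one_of_forall_norm_embedding_le_one 2 (ha P hP) v hv'

/-- The local height at `v ∣ 2` is controlled by `a·ord_v(2)` once `2^a·j(λ)` is `v`-integral:
`h_v = max(0, −ord_v(j(λ))) ≤ a·ord_v(2)`. [cite: Mochizuki2012, Cor 2.2 (i) p.41] -/
theorem localHeight_le_of_valuation_le_one (P : NFPoint) (v : HeightOneSpectrum (𝓞 P.F)) (a : ℕ)
    (h : v.valuation P.F ((2 : P.F) ^ a * jInv P.x) ≤ 1) :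
    localHeight P v ≤ a * (ord P.F v (2 : P.F) : ℝ) := by
  have h2 : 0 ≤ ord P.F v (2 : P.F) := by
    have := ord_nonneg_of_isIntegral P.F v (2 : 𝓞 P.F)
    rwa [NumberField.RingOfIntegers.coe_eq_algebraMap, map_ofNat] at this
  have hbound : ((-(ord P.F v (jInv P.x))).toNat : ℤ) ≤ a * ord P.F v (2 : P.F) := by
    by_cases hj : jInv P.x = 0
    · rw [hj, ord_zero, neg_zero, Int.toNat_zero, Nat.cast_zero]
      positivity
    · have h20 : (2 : P.F) ^ a ≠ 0 := pow_ne_zero _ two_ne_zero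
      have hord : 0 ≤ ord P.F v ((2 : P.F) ^ a * jInv P.x) :=
        ord_nonneg_of_valuation_le_one v (mul_ne_zero h20 hj) h
      rw [ord_mul P.F v h20 hj, ord_pow] at hord
      have hle : -(ord P.F v (jInv P.x)) ≤ a * ord P.F v (2 : P.F) := by linarith
      rcases le_or_gt 0 (-(ord P.F v (jInv P.x))) with hnn | hneg
      · rwa [Int.toNat_of_nonneg hnn]
      · rw [Int.toNat_eq_zero.mpr hneg.le, Nat.cast_zero]
        positivity
  unfold localHeight
  have := (Int.cast_le (R := ℝ)).mpr hbound
  push_cast at this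
  exact_mod_cast this

open scoped Classical in
/-- **The 2-adic part of `log(q^∀)` is bounded on `K_V`**: there is `a ∈ ℕ` with
`Σ_{v ∣ 2, bad} h_v·log N(v) ≤ a·[F:ℚ]·log 2` for every `P = (F, λ) ∈ K_V` (sum `h_v ≤ a·e_v`
against `log N(v) = f_v·log 2` and use `Σ_{v∣2} e_v f_v = [F:ℚ]`).
[cite: Mochizuki2012, Cor 2.2 (i) p.41] -/
theorem exists_sum_localHeight_two_le (hD : Hypotheses D) :
    ∃ a : ℕ, ∀ P ∈ D.toSet,
      ∑ v ∈ (badPlaces P).filter (fun v => (2 : 𝓞 P.F) ∈ v.asIdeal),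
        localHeight P v * logNorm P.F v ≤ a * (Module.finrank ℚ P.F * Real.log 2) := by
  obtain ⟨a, ha⟩ := exists_valuation_two_pow_mul_jInv_le_one hD
  refine ⟨a, fun P hP => ?_⟩
  have hterm : ∀ v ∈ (badPlaces P).filter (fun v => (2 : 𝓞 P.F) ∈ v.asIdeal),
      localHeight P v * logNorm P.F v ≤ a * Real.log 2 * localDegree P.F v := by
    intro v hv
    rw [Finset.mem_filter] at hv
    have hvp : v ∈ placesOver P.F 2 := mem_placesOver_of_natCast_mem 2 v (by simpa using hv.2)
    have hres : residueChar P.F v = 2 := (mem_placesOver_iff_residueChar v).mp hvp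
    have hord : (ord P.F v (2 : P.F) : ℝ) = ramIdx P.F v := by
      have := ord_natCast_eq_ramIdx 2 v hvp
      push_cast at this
      exact_mod_cast this
    have hlh : localHeight P v ≤ a * (ramIdx P.F v : ℝ) := by
      rw [← hord]; exact localHeight_le_of_valuation_le_one P v a (ha P hP v hv.2)
    have hln : logNorm P.F v = resDeg P.F v * Real.log 2 := by
      rw [logNorm_eq, hres]; norm_num
    rw [hln, localDegree, Nat.cast_mul]
    have hf : (0 : ℝ) ≤ resDeg P.F v * Real.log 2 := by positivity
    calc localHeight P v * (resDeg P.F v * Real.log 2)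
        ≤ a * (ramIdx P.F v : ℝ) * (resDeg P.F v * Real.log 2) :=
          mul_le_mul_of_nonneg_right hlh hf
      _ = a * Real.log 2 * (ramIdx P.F v * resDeg P.F v : ℝ) := by ring
  have hsub : (badPlaces P).filter (fun v => (2 : 𝓞 P.F) ∈ v.asIdeal) ⊆ placesOver P.F 2 :=
    fun v hv => mem_placesOver_of_natCast_mem 2 v (by simpa using (Finset.mem_filter.mp hv).2)
  calc ∑ v ∈ (badPlaces P).filter (fun v => (2 : 𝓞 P.F) ∈ v.asIdeal), localHeight P v * logNorm P.F v
      ≤ ∑ v ∈ (badPlaces P).filter (fun v => (2 : 𝓞 P.F) ∈ v.asIdeal),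
          a * Real.log 2 * (localDegree P.F v : ℝ) := Finset.sum_le_sum hterm
    _ ≤ ∑ v ∈ placesOver P.F 2, a * Real.log 2 * (localDegree P.F v : ℝ) :=
        Finset.sum_le_sum_of_subset_of_nonneg hsub fun v _ _ => by positivity
    _ = a * Real.log 2 * ∑ v ∈ placesOver P.F 2, (localDegree P.F v : ℝ) := by
        rw [Finset.mul_sum]
    _ = a * (Module.finrank ℚ P.F * Real.log 2) := by
        rw [← Nat.cast_sum, sum_localDegree]; ring

open scoped Classical in
/-- **`log(q^∀) ≤ log(q^{∤2}) + a·log 2` on `K_V`** — the two functions differ by the normalised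
degree of the 2-adic part of the `q`-parameter divisor, which is bounded by
`exists_sum_localHeight_two_le`. [cite: Mochizuki2012, Cor 2.2 (i) p.41] -/
theorem exists_logQForall_le_logQNotTwo_add (hD : Hypotheses D) :
    ∃ B : ℝ, ∀ P ∈ D.toSet, logQForall P ≤ logQNotTwo P + B := by
  obtain ⟨a, ha⟩ := exists_sum_localHeight_two_le hD
  refine ⟨a * Real.log 2, fun P hP => ?_⟩
  have hsplit : qDivisor P ∅ = qDivisor P {2} +
      ∑ v ∈ (badPlaces P).filter (fun v => (2 : 𝓞 P.F) ∈ v.asIdeal),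
        FinDivisor.of v (localHeight P v) := by
    unfold qDivisor
    rw [Finset.filter_true_of_mem (fun v _ => by simp),
      ← Finset.sum_filter_add_sum_filter_not (badPlaces P) (fun v => (2 : 𝓞 P.F) ∈ v.asIdeal),
      add_comm]
    congr 1
    refine Finset.sum_congr (Finset.filter_congr fun v _ => ?_) fun _ _ => rfl
    simp
  have hn : (0 : ℝ) < Module.finrank ℚ P.F := FinDivisor.finrank_pos
  unfold logQForall logQNotTwo logQAvoid
  rw [hsplit, map_add, add_le_add_iff_left, FinDivisor.ndeg_apply, FinDivisor.deg_sum_of,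
    div_le_iff₀ hn]
  calc ∑ v ∈ (badPlaces P).filter (fun v => (2 : 𝓞 P.F) ∈ v.asIdeal), localHeight P v * logNorm P.F v
      ≤ a * (Module.finrank ℚ P.F * Real.log 2) := ha P hP
    _ = a * Real.log 2 * Module.finrank ℚ P.F := by ring

/-- **[IUTchIV] Cor. 2.2 (i), first equivalence `(1/6)·log(q^{∤2}) ≈ (1/6)·log(q^∀)` on `K_V`**
(p. 41; proof p. 44: "follows from condition (∗^{j-inv})"), PROVED: the first conjunct of
`Cor22.PartI D` under `Cor22.Hypotheses D`. [cite: Mochizuki2012, Cor 2.2 (i) p.41] -/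
theorem partI_first (hD : Hypotheses D) :
    BDEquiv D.toSet (fun P => 1 / 6 * logQNotTwo P) (fun P => 1 / 6 * logQForall P) := by
  obtain ⟨B, hB⟩ := exists_logQForall_le_logQNotTwo_add hD
  refine ⟨B / 6, fun P hP => ?_⟩
  have h1 : logQNotTwo P ≤ logQForall P := logQAvoid_anti P (Finset.empty_subset _)
  have h2 := hB P hP
  rw [abs_le]
  constructor <;> linarith

end Cor22

end Literature.IUT.LogVolume

end
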